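import Literature.Barriers.SmoothPoincare4.ExoticContractibleKangProofs
import Literature.Barriers.SmoothPoincare4.ExoticContractibleKangStabilisationProofs
import Literature.Topology.FourManifolds.HandlebodySymmetricModels
import HarnessLib

/-!
# `akbulutRuberman2016_theoremB` at universe `0` implies it at every universe

Fourth sibling proof file of `Literature/Barriers/SmoothPoincare4/ExoticContractible.lean` for the
named fact `Literature.Barriers.SmoothPoincare4.akbulutRuberman2016_theoremB` (S. Akbulut,
D. Ruberman, *Absolutely exotic compact 4-manifolds*, Comment. Math. Helv. 91 (2016) 1–19,
Thm. B, first assertion: "There are compact contractible smooth 4-manifolds `V` and `V′` with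
diffeomorphic boundaries, such that they are homeomorphic but not diffeomorphic to each other").
Everything here is proved; no definition and no named fact is introduced.

## Why

The fact is universe polymorphic (`∃ (V V' : Type u) …`, `universe u` in `ExoticContractible.lean`),
and so is the printed route to it (`akbulutRuberman2016_theoremB_of_theoremA`,
`ExoticContractibleProofs.lean`: cork + Thm. A + Freedman–Quinn, all three leaves stated at `Type u`).
The second route in the tree, from S. Kang's one-stabilisation pair
(`akbulutRuberman2016_theoremB_of_kang`, `ExoticContractibleKangProofs.lean`: Kang 2022, Cor. 1.2 +
well-definedness of `W # (S² × S²)`), and the cork-theorem assembly of the printed route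
(`akbulutRuberman2016_theoremB_of_corkTheorem`, same file) only reach `akbulutRuberman2016_theoremB.{0}`,
because their leaves (`kang2022_corollary12`, Matveyev's decomposition, the Akhmedov–Park pair) are
stated over `Type`.  This file closes that gap: **Thm. B at universe `0` implies Thm. B at every
universe `u`** (`akbulutRuberman2016_theoremB_of_univ_zero`), hence so do Kang's leaves
(`akbulutRuberman2016_theoremB_univ_of_kang`) and the barrier `ContractibleBarrierFour.{u}` follows
from universe-`0` leaves (`contractibleBarrierFour_univ_of_univ_zero`, `contractibleBarrierFour_univ_of_kang`).
With the well-definedness of `W # (S² × S²)` now proved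
(`nonempty_diffeomorph_of_isConnectedSum_sphereTwoProd_holds`,
`ExoticContractibleKangStabilisationProofs.lean`), the Kang route at every universe is reduced to
its last leaf: **`akbulutRuberman2016_theoremB.{u}` from `kang2022_corollary12` alone**
(`akbulutRuberman2016_theoremB_univ_of_kang2022_corollary12`; Kang 2022, Cor. 1.2, whose own leaf
is the involutive bordered Heegaard Floer computation of Thm. 1.1 there), and likewise
`ContractibleBarrierFour.{u}` (`contractibleBarrierFour_univ_of_kang2022_corollary12`) and
`OneStabilisationBarrier → ContractibleBarrierFour.{u}`
(`contractibleBarrierFour_univ_of_oneStabilisationBarrier_unconditional`).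

## The argument ([folklore]; the pattern of `BordismFourUniverse.lean`, `SmaleHomologySpheresUniverse.lean`)

Given the universe-`0` pair `V`, `V'`, the pair `ULift.{u} V`, `ULift.{u} V'` is a witness at
universe `u`: `ULift M` carries the lifted charts and is a `C^∞` manifold with corners for the same
model, canonically diffeomorphic to `M` (`ManifoldULift.instChartedSpace`, `instIsManifold`,
`ManifoldULift.diffeomorph`, `ManifoldULift.lean`); it is Hausdorff, second countable, compact and
contractible with `M` (Mathlib instances, `ManifoldULift.instSecondCountableTopology`,
`Homeomorph.ulift.contractibleSpace_iff`); a boundary datum `b` of `M` lifts to the boundary datum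
`b.ulift` of `ULift M` with boundary manifold `ULift ∂M` (`BoundaryData.ulift`,
`HandlebodySymmetricModels.lean`), so `∂V ≅ ∂V'` lifts by conjugation with
`ManifoldULift.diffeomorph`; `V ≃ₜ V'` lifts by conjugation with `Homeomorph.ulift`; and a
diffeomorphism `ULift V ≅ ULift V'` would conjugate to a diffeomorphism `V ≅ V'`, so there is none.
The fact itself remains open (its leaves are gauge/Floer-theoretic, see the census in
`ExoticContractibleKangProofs.lean`); what is reduced is only its universe polymorphism.

## References

* S. Akbulut, D. Ruberman, *Absolutely exotic compact 4-manifolds*, Comment. Math. Helv. 91 (2016)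
  1–19 (arXiv:1410.1461v3), Thm. B and its proof (§3). [AkbulutRuberman2016]
* S. Kang, *One stabilization is not enough for contractible 4-manifolds*, arXiv:2210.07510, Cor. 1.2.
  [Kang2022OneStabilization]
* J. M. Lee, *Introduction to Smooth Manifolds*, 2nd ed., GTM 218 (2013), Ch. 1 (smooth structures
  transported along homeomorphisms; diffeomorphism invariance). [LeeSmoothManifolds2013]
-/

noncomputable section

open scoped Manifold ContDiff
open Function
open Literature.Topology.FourManifolds

namespace Literature.Barriers.SmoothPoincare4

universe u

/-- **Akbulut–Ruberman 2016, Thm. B (first assertion): universe `0` implies universe `u`.**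
Lift the universe-`0` pair `V`, `V'` along `ULift.{u}`: manifold structure, separation,
countability, compactness (`ManifoldULift.lean`, Mathlib), contractibility
(`Homeomorph.ulift.contractibleSpace_iff`), boundary data (`BoundaryData.ulift`), the boundary
diffeomorphism and the homeomorphism (conjugation with `ManifoldULift.diffeomorph`,
`Homeomorph.ulift`), and non-diffeomorphism (a diffeomorphism of the lifts conjugates down).
[folklore] [cite: AkbulutRuberman2016, Thm. B] -/
theorem akbulutRuberman2016_theoremB_of_univ_zero (h : akbulutRuberman2016_theoremB.{0}) :
    akbulutRuberman2016_theoremB.{u} := by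
  obtain ⟨V, V', _, _, _, _, _, _, _, _, _, _, _, _, _, _, b, b', ⟨φ⟩, ⟨e⟩, hE⟩ := h
  haveI : ContractibleSpace (ULift.{u} V) := Homeomorph.ulift.contractibleSpace_iff.mpr ‹_›
  haveI : ContractibleSpace (ULift.{u} V') := Homeomorph.ulift.contractibleSpace_iff.mpr ‹_›
  refine ⟨ULift.{u} V, ULift.{u} V', inferInstance, inferInstance, inferInstance, inferInstance,
    inferInstance, inferInstance, inferInstance, inferInstance, inferInstance, inferInstance,
    inferInstance, inferInstance, inferInstance, inferInstance, b.ulift, b'.ulift, ?_, ?_, ?_⟩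
  · exact ⟨(ManifoldULift.diffeomorph (𝓡 3) b.carrier ∞).trans
      (φ.trans (ManifoldULift.diffeomorph (𝓡 3) b'.carrier ∞).symm)⟩
  · exact ⟨Homeomorph.ulift.trans (e.trans Homeomorph.ulift.symm)⟩
  · exact ⟨fun Φ => hE.false ((ManifoldULift.diffeomorph (𝓡∂ 4) V ∞).symm.trans
      (Φ.trans (ManifoldULift.diffeomorph (𝓡∂ 4) V' ∞)))⟩

/-- **Thm. B at every universe from Kang's Cor. 1.2** (`kang2022_corollary12`, stated over `Type`)
and well-definedness of the stabilisation `W # (S² × S²)`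
(`nonempty_diffeomorph_of_isConnectedSum_sphereTwoProd`): the universe-`0` assembly
`akbulutRuberman2016_theoremB_of_kang` lifted by `akbulutRuberman2016_theoremB_of_univ_zero`.
[cite: Kang2022OneStabilization, Cor. 1.2] [cite: AkbulutRuberman2016, Thm. B] -/
theorem akbulutRuberman2016_theoremB_univ_of_kang (hK : kang2022_corollary12)
    (hU : nonempty_diffeomorph_of_isConnectedSum_sphereTwoProd) :
    akbulutRuberman2016_theoremB.{u} :=
  akbulutRuberman2016_theoremB_of_univ_zero (akbulutRuberman2016_theoremB_of_kang hK hU)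

/-- **Thm. B at every universe from the leaves of Kang's proof**: Kang's Thm. 1.1 pair
(`kang2022_oneStabilisationExoticPair`), Freedman–Quinn at universe `0`, and well-definedness of
the stabilisation. [cite: Kang2022OneStabilization, Thm. 1.1 and Cor. 1.2] [cite: AkbulutRuberman2016, Thm. B] -/
theorem akbulutRuberman2016_theoremB_univ_of_kangExoticPair (hK : kang2022_oneStabilisationExoticPair)
    (hF : freedmanQuinn1990_homeomorph_extends_contractible.{0})
    (hU : nonempty_diffeomorph_of_isConnectedSum_sphereTwoProd) :
    akbulutRuberman2016_theoremB.{u} :=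
  akbulutRuberman2016_theoremB_of_univ_zero (akbulutRuberman2016_theoremB_of_kangExoticPair hK hF hU)

/-- **The barrier at every universe from Thm. B at universe `0`.**
[cite: AkbulutRuberman2016, Thm. B] -/
theorem contractibleBarrierFour_univ_of_univ_zero (h : akbulutRuberman2016_theoremB.{0}) :
    ContractibleBarrierFour.{u} :=
  contractibleBarrierFour_of_akbulutRuberman (akbulutRuberman2016_theoremB_of_univ_zero h)

/-- **The barrier at every universe from Kang's Cor. 1.2** and well-definedness of the
stabilisation. [cite: Kang2022OneStabilization, Cor. 1.2] [cite: AkbulutRuberman2016, Thm. B] -/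
theorem contractibleBarrierFour_univ_of_kang (hK : kang2022_corollary12)
    (hU : nonempty_diffeomorph_of_isConnectedSum_sphereTwoProd) : ContractibleBarrierFour.{u} :=
  contractibleBarrierFour_of_akbulutRuberman (akbulutRuberman2016_theoremB_univ_of_kang hK hU)

/-- **Kang's barrier (universe `0`) implies Akbulut–Ruberman's at every universe**, given
well-definedness of the stabilisation. [cite: Kang2022OneStabilization, Cor. 1.2] -/
theorem contractibleBarrierFour_univ_of_oneStabilisationBarrier (h : OneStabilisationBarrier)
    (hU : nonempty_diffeomorph_of_isConnectedSum_sphereTwoProd) : ContractibleBarrierFour.{u} :=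
  contractibleBarrierFour_univ_of_kang (kang2022_corollary12_of_oneStabilisationBarrier h) hU

/-! ### The Kang route at every universe, reduced to its last leaf -/

/-- **Akbulut–Ruberman 2016, Thm. B (first assertion) at every universe from Kang's Cor. 1.2
alone**: the universe-`0` theorem `akbulutRuberman2016_theoremB_of_kang2022_corollary12`
(`ExoticContractibleKangStabilisationProofs.lean`: Kang's pair, the stabilisation hypothesis
discharged by `nonempty_diffeomorph_of_isConnectedSum_sphereTwoProd_holds`) lifted by
`akbulutRuberman2016_theoremB_of_univ_zero`. In the tree's DAG this leaves ONE named fact below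
`akbulutRuberman2016_theoremB.{u}` on this route: `kang2022_corollary12` ("an absolutely exotic pair
of contractible 4-manifolds which remains absolutely exotic after one stabilization", Kang, §1).
[cite: Kang2022OneStabilization, §1 and Cor. 1.2] [cite: AkbulutRuberman2016, Thm. B] -/
theorem akbulutRuberman2016_theoremB_univ_of_kang2022_corollary12 (hK : kang2022_corollary12) :
    akbulutRuberman2016_theoremB.{u} :=
  akbulutRuberman2016_theoremB_of_univ_zero (akbulutRuberman2016_theoremB_of_kang2022_corollary12 hK)

/-- **Thm. B at every universe from Kang's Thm. 1.1 pair and Freedman–Quinn (universe `0`)**: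
`akbulutRuberman2016_theoremB_of_kangExoticPair_freedmanQuinn` lifted.
[cite: Kang2022OneStabilization, Thm. 1.1 and proof of Cor. 1.2 (§5)] [cite: AkbulutRuberman2016, Thm. B] -/
theorem akbulutRuberman2016_theoremB_univ_of_kangExoticPair_freedmanQuinn
    (hK : kang2022_oneStabilisationExoticPair)
    (hF : freedmanQuinn1990_homeomorph_extends_contractible.{0}) :
    akbulutRuberman2016_theoremB.{u} :=
  akbulutRuberman2016_theoremB_of_univ_zero
    (akbulutRuberman2016_theoremB_of_kangExoticPair_freedmanQuinn hK hF)

/-- **`ContractibleBarrierFour` at every universe from Kang's Cor. 1.2 alone.**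
[cite: Kang2022OneStabilization, Cor. 1.2] [cite: AkbulutRuberman2016, Thm. B] -/
theorem contractibleBarrierFour_univ_of_kang2022_corollary12 (hK : kang2022_corollary12) :
    ContractibleBarrierFour.{u} :=
  contractibleBarrierFour_univ_of_univ_zero (akbulutRuberman2016_theoremB_of_kang2022_corollary12 hK)

/-- **Kang's barrier implies Akbulut–Ruberman's at every universe, unconditionally**:
`OneStabilisationBarrier → ContractibleBarrierFour.{u}`.
[cite: Kang2022OneStabilization, §1 and Cor. 1.2] -/
theorem contractibleBarrierFour_univ_of_oneStabilisationBarrier_unconditional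
    (h : OneStabilisationBarrier) : ContractibleBarrierFour.{u} :=
  contractibleBarrierFour_univ_of_kang2022_corollary12
    (kang2022_corollary12_of_oneStabilisationBarrier h)

end Literature.Barriers.SmoothPoincare4

end
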